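import Literature.NumberTheory.EllipticCurves.IwasawaAlgebraOmegaLimit
import Mathlib.RingTheory.PowerSeries.WeierstrassPreparation
import Mathlib.Data.Nat.Multiplicity
import Mathlib.Algebra.Polynomial.Taylor
import Mathlib.Algebra.Polynomial.Degree.Support
import HarnessLib

/-!
# `Λ(ℤ_p, S) = lim←_n S[ℤ/p^nℤ] ≅ S⟦X⟧`: compatible families of `S`-valued functions on the `ℤ/p^nℤ` are the Iwasawa algebra
# (the algebraic Amice / Iwasawa isomorphism `μ ↦ ∫ (1+X)^x dμ(x)`, Washington Thm. 7.1)

Washington, *Introduction to Cyclotomic Fields* (1997), §7.1 and Theorem 7.1: `ℤ_p[ℤ/p^nℤ] ≅ ℤ_p[T]/((1+T)^{p^n} − 1)` (`γ ↦ 1 + T`) and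
`ℤ_p⟦T⟧ ≅ lim← ℤ_p[T]/((1+T)^{p^n} − 1)`, the second step by division by the distinguished polynomials `ω_n = (1+T)^{p^n} − 1`
(Prop. 7.2); de Shalit (1987) I §3.1 (1): `P_μ(S) = ∫_{ℤ_p} (1+S)^α dμ(α)`.  For a commutative ring `S` that is `(p)`-adically complete with
`p` not a unit, and functions `a_n : ℤ/p^nℤ → S` (an `S`-valued distribution on `ℤ_p` when compatible under push-forward), put
`Φ_n(a) := Σ_x a(x)·(1+X)^{x} ∈ S⟦X⟧` (`x` read in `{0, …, p^n − 1}`).  This file proves: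

* `isWeierstrassDivisorAt_omega` — `ω_n ≡ X^{p^n} (mod p)` is a Weierstrass divisor at `(p)` (Mathlib's Weierstrass division applies);
* ★ `omega_dvd_amice_sub_amice_pushforward` — `ω_n ∣ Φ_{n+1}(a) − Φ_n(push a)` (`(1+X)^y ≡ (1+X)^{y mod p^n}`): compatible families give
  compatible residues, hence (★★ `existsUnique_forall_omega_dvd_sub_amice`, by `IwasawaAlgebraOmegaLimit`) ONE power series
  `g = "∫ (1+X)^x da"` with `g ≡ Φ_n(a_n) (mod ω_n)` for all `n`;
* ★★ `existsUnique_omega_dvd_sub_amice` — at each level every `f ∈ S⟦X⟧` is `≡ Φ_n(a) (mod ω_n)` for a UNIQUE `a : ℤ/p^nℤ → S`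
  (`S⟦X⟧/(ω_n) ≅ S[ℤ/p^nℤ]`: Weierstrass division by `ω_n` + the binomial basis `(1+X)^x`, `x < p^n`, via `Polynomial.taylor`);
* ★★★ `existsUnique_compatible_amice` — **every `g ∈ S⟦X⟧` is `∫(1+X)^x da` for a UNIQUE push-forward-compatible family `(a_n)`**.

Together: `S⟦X⟧ ≅ Λ(ℤ_p, S)`, `S`-linearly, for `S = ℤ_p, 𝒪_F, 𝒪_E, …`.  Everything PROVED (0 sorry, no named facts, no new definitions).
Use (brick (c) of the BSD cell): the unramified half of the `Λ`-structure of the Coleman coordinates — `lim←_{Tr} 𝒪_{E_m}` is the module of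
compatible function families on the cyclic `Gal(E_m/F)` (`LubinTateUnramifiedTowerCoordinates`), i.e. `𝒪_F⟦X⟧` for a `ℤ_p`-tower.

## References

* L. C. Washington, *Introduction to Cyclotomic Fields*, 2nd ed. (1997), §7.1, Thm. 7.1, Prop. 7.2. [Washington1997]
* E. de Shalit, *Iwasawa theory of elliptic curves with complex multiplication* (1987), Ch. I §3.1 (1). [deShalit1987]
-/

noncomputable section

namespace Literature.NumberTheory.EllipticCurves

namespace IwasawaOmega

open Literature.NumberTheory.GaloisRepresentations.LubinTate Finset

variable {S : Type*} [CommRing S] (p : ℕ) [hp : Fact p.Prime]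

/-! ### `ω_n` is a Weierstrass divisor at `(p)` -/

omit hp in
/-- The coefficients of `(1+X)^N − 1`: `0` in degree `0`, `C(N, k)` in degree `k ≥ 1`. [cite: Washington1997, §7.1 Theorem 7.1] -/
theorem coeff_omega (N k : ℕ) :
    PowerSeries.coeff k ((1 + PowerSeries.X : PowerSeries S) ^ N - 1) = if k = 0 then 0 else (N.choose k : S) := by
  have e : ((1 + PowerSeries.X : PowerSeries S) ^ N) = (((1 + Polynomial.X : Polynomial S) ^ N : Polynomial S) : PowerSeries S) := by
    rw [Polynomial.coe_pow, Polynomial.coe_add, Polynomial.coe_one, Polynomial.coe_X]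
  rw [map_sub, e, Polynomial.coeff_coe, Polynomial.coeff_one_add_X_pow, PowerSeries.coeff_one]
  split_ifs with hk
  · subst hk; rw [Nat.choose_zero_right, Nat.cast_one, sub_self]
  · rw [sub_zero]

/-- **`ω_n ≡ X^{p^n} (mod p)`** (`p ∣ C(p^n, k)` for `0 < k < p^n`). [cite: Washington1997, §7.1 Theorem 7.1] -/
theorem map_omega_eq_X_pow (n : ℕ) :
    PowerSeries.map (Ideal.Quotient.mk (Ideal.span {(p : S)})) ((1 + PowerSeries.X : PowerSeries S) ^ p ^ n - 1) =
      PowerSeries.X ^ p ^ n := by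
  ext k
  rw [PowerSeries.coeff_map, coeff_omega, PowerSeries.coeff_X_pow]
  by_cases h0 : k = 0
  · subst h0
    rw [if_pos rfl, map_zero, if_neg (pow_ne_zero n hp.out.ne_zero).symm]
  · rw [if_neg h0]
    by_cases hk : k = p ^ n
    · subst hk; rw [Nat.choose_self, Nat.cast_one, map_one, if_pos rfl]
    · rw [if_neg hk, Ideal.Quotient.eq_zero_iff_mem, Ideal.mem_span_singleton]
      exact Nat.cast_dvd_cast (hp.out.dvd_choose_pow h0 hk)

/-- The order of `ω_n mod p` is `p^n` (`p` not a unit in `S`). [cite: Washington1997, §7.1 Proposition 7.2] -/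
theorem order_map_omega (hI : Ideal.span {(p : S)} ≠ ⊤) (n : ℕ) :
    (PowerSeries.map (Ideal.Quotient.mk (Ideal.span {(p : S)})) ((1 + PowerSeries.X : PowerSeries S) ^ p ^ n - 1)).order.toNat = p ^ n := by
  haveI : Nontrivial (S ⧸ Ideal.span {(p : S)}) := Ideal.Quotient.nontrivial_iff.mpr hI
  rw [map_omega_eq_X_pow, PowerSeries.order_X_pow]
  rfl

/-- **`ω_n` is a Weierstrass divisor at `(p)`** (its `p^n`-th coefficient is `1`). [cite: Washington1997, §7.1 Proposition 7.2] -/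
theorem isWeierstrassDivisorAt_omega (hI : Ideal.span {(p : S)} ≠ ⊤) (n : ℕ) :
    PowerSeries.IsWeierstrassDivisorAt ((1 + PowerSeries.X : PowerSeries S) ^ p ^ n - 1) (Ideal.span {(p : S)}) := by
  rw [PowerSeries.IsWeierstrassDivisorAt, order_map_omega p hI, coeff_omega, if_neg (pow_ne_zero n hp.out.ne_zero), Nat.choose_self,
    Nat.cast_one]
  exact isUnit_one

/-! ### The finite Amice transform `Φ_n(a) = Σ_x a(x)(1+X)^x` and its coefficient polynomial `Σ_x a(x) X^x` -/

/-- `Φ_n(a)` is the power series of `taylor 1 (Σ_x a(x) X^x)`. [cite: Washington1997, §7.1 Theorem 7.1] -/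
theorem coe_taylor_sum_monomial (n : ℕ) (a : ZMod (p ^ n) → S) :
    ((Polynomial.taylor (1 : S) (∑ x : ZMod (p ^ n), Polynomial.monomial x.val (a x)) : Polynomial S) : PowerSeries S) =
      ∑ x : ZMod (p ^ n), PowerSeries.C (a x) * (1 + PowerSeries.X) ^ x.val := by
  rw [map_sum, ← Polynomial.coeToPowerSeries.ringHom_apply, map_sum]
  refine sum_congr rfl fun x _ => ?_
  rw [Polynomial.taylor_monomial, Polynomial.coeToPowerSeries.ringHom_apply, Polynomial.coe_mul, Polynomial.coe_C, Polynomial.coe_pow,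
    Polynomial.C_1, Polynomial.coe_add, Polynomial.coe_one, Polynomial.coe_X, add_comm]

/-- The coefficient polynomial has degree `< p^n`. [cite: Washington1997, §7.1 Theorem 7.1] -/
theorem natDegree_sum_monomial_lt (n : ℕ) (a : ZMod (p ^ n) → S) :
    (∑ x : ZMod (p ^ n), Polynomial.monomial x.val (a x)).natDegree < p ^ n := by
  haveI : NeZero (p ^ n) := ⟨pow_ne_zero _ hp.out.ne_zero⟩
  have hpos : 0 < p ^ n := pow_pos hp.out.pos n
  refine lt_of_le_of_lt (Polynomial.natDegree_sum_le_of_forall_le _ _ fun x _ => ?_) (Nat.sub_lt hpos Nat.one_pos)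
  exact (Polynomial.natDegree_monomial_le _).trans (Nat.le_sub_one_of_lt (ZMod.val_lt x))

/-- The coefficients of the coefficient polynomial are the values of `a`. [cite: Washington1997, §7.1 Theorem 7.1] -/
theorem coeff_sum_monomial (n : ℕ) (a : ZMod (p ^ n) → S) (x : ZMod (p ^ n)) :
    (∑ y : ZMod (p ^ n), Polynomial.monomial y.val (a y)).coeff x.val = a x := by
  haveI : NeZero (p ^ n) := ⟨pow_ne_zero _ hp.out.ne_zero⟩
  rw [Polynomial.finsetSum_coeff, sum_eq_single x]
  · rw [Polynomial.coeff_monomial, if_pos rfl]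
  · intro y _ hyx
    rw [Polynomial.coeff_monomial, if_neg fun h => hyx (ZMod.val_injective _ h)]
  · intro h; exact absurd (mem_univ x) h

/-- `a` is determined by its coefficient polynomial. [cite: Washington1997, §7.1 Theorem 7.1] -/
theorem eq_of_sum_monomial_eq (n : ℕ) {a a' : ZMod (p ^ n) → S}
    (h : (∑ x : ZMod (p ^ n), Polynomial.monomial x.val (a x)) = ∑ x : ZMod (p ^ n), Polynomial.monomial x.val (a' x)) : a = a' := by
  funext x
  rw [← coeff_sum_monomial p n a x, h, coeff_sum_monomial]

omit hp in
/-- A sum over `range N` is a sum over `ZMod N` through `val`. [cite: Washington1997, §7.1 Theorem 7.1] -/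
theorem sum_range_eq_sum_zmod {M : Type*} [AddCommMonoid M] (N : ℕ) [NeZero N] (G : ℕ → M) :
    ∑ i ∈ range N, G i = ∑ x : ZMod N, G x.val := by
  refine sum_bij' (fun i _ => (i : ZMod N)) (fun x _ => x.val) (fun i _ => mem_univ _) (fun x _ => mem_range.mpr (ZMod.val_lt x))
    (fun i hi => ?_) (fun x _ => ZMod.natCast_zmod_val x) (fun i hi => ?_)
  · rw [ZMod.val_natCast, Nat.mod_eq_of_lt (mem_range.mp hi)]
  · rw [ZMod.val_natCast, Nat.mod_eq_of_lt (mem_range.mp hi)]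

/-! ### Compatible families give compatible residues -/

omit hp in
/-- `ω_n ∣ (1+X)^v − (1+X)^{v mod p^n}`. [cite: Washington1997, §7.1 Theorem 7.1] -/
theorem omega_dvd_one_add_X_pow_sub (n v : ℕ) :
    ((1 + PowerSeries.X : PowerSeries S) ^ p ^ n - 1) ∣ (1 + PowerSeries.X : PowerSeries S) ^ v - (1 + PowerSeries.X) ^ (v % p ^ n) := by
  have e : (1 + PowerSeries.X : PowerSeries S) ^ v - (1 + PowerSeries.X) ^ (v % p ^ n) =
      (((1 + PowerSeries.X : PowerSeries S) ^ p ^ n) ^ (v / p ^ n) - 1 ^ (v / p ^ n)) * (1 + PowerSeries.X) ^ (v % p ^ n) := by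
    nth_rw 1 [← Nat.div_add_mod v (p ^ n)]
    rw [pow_add, pow_mul, one_pow, sub_mul, one_mul]
  rw [e]
  exact Dvd.dvd.mul_right (sub_dvd_pow_sub_pow _ 1 _) _

/-- The push-forward of `a : ℤ/p^{n+1} → S` read through `(1+X)^{x mod p^n}`: `Φ_n(push a) = Σ_y a(y)(1+X)^{y mod p^n}`.
[cite: Washington1997, §7.1 Theorem 7.1] -/
theorem amice_pushforward_eq (n : ℕ) (a : ZMod (p ^ (n + 1)) → S) :
    open scoped Classical in
    (∑ x : ZMod (p ^ n), PowerSeries.C (∑ y ∈ univ.filter (fun y : ZMod (p ^ (n + 1)) =>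
        ZMod.castHom (pow_dvd_pow p n.le_succ) (ZMod (p ^ n)) y = x), a y) * (1 + PowerSeries.X) ^ x.val) =
      ∑ y : ZMod (p ^ (n + 1)), PowerSeries.C (a y) * (1 + PowerSeries.X) ^ (y.val % p ^ n) := by
  classical
  haveI : NeZero (p ^ (n + 1)) := ⟨pow_ne_zero _ hp.out.ne_zero⟩
  have hval : ∀ y : ZMod (p ^ (n + 1)), (ZMod.castHom (pow_dvd_pow p n.le_succ) (ZMod (p ^ n)) y).val = y.val % p ^ n := fun y => by
    rw [ZMod.castHom_apply, ZMod.cast_eq_val, ZMod.val_natCast]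
  rw [← sum_fiberwise univ (ZMod.castHom (pow_dvd_pow p n.le_succ) (ZMod (p ^ n)))
    (fun y : ZMod (p ^ (n + 1)) => PowerSeries.C (a y) * (1 + PowerSeries.X) ^ (y.val % p ^ n))]
  refine sum_congr rfl fun x _ => ?_
  rw [map_sum, sum_mul]
  refine sum_congr rfl fun y hy => ?_
  rw [← hval y, (mem_filter.mp hy).2]

/-- ★ **`ω_n ∣ Φ_{n+1}(a) − Φ_n(push a)`**: the finite Amice transforms of a function on `ℤ/p^{n+1}` and of its push-forward to `ℤ/p^n` agree
modulo `ω_n`. [cite: Washington1997, §7.1 Theorem 7.1] -/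
theorem omega_dvd_amice_sub_amice_pushforward (n : ℕ) (a : ZMod (p ^ (n + 1)) → S) :
    open scoped Classical in
    ((1 + PowerSeries.X : PowerSeries S) ^ p ^ n - 1) ∣
      (∑ y : ZMod (p ^ (n + 1)), PowerSeries.C (a y) * (1 + PowerSeries.X) ^ y.val) -
        ∑ x : ZMod (p ^ n), PowerSeries.C (∑ y ∈ univ.filter (fun y : ZMod (p ^ (n + 1)) =>
          ZMod.castHom (pow_dvd_pow p n.le_succ) (ZMod (p ^ n)) y = x), a y) * (1 + PowerSeries.X) ^ x.val := by
  classical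
  rw [amice_pushforward_eq, ← sum_sub_distrib]
  refine dvd_sum fun y _ => ?_
  rw [← mul_sub]
  exact Dvd.dvd.mul_left (omega_dvd_one_add_X_pow_sub p n y.val) _

/-! ### The limit: compatible families ↦ one power series -/

/-- ★★ **A push-forward-compatible family `(a_n : ℤ/p^n → S)` has a UNIQUE Amice transform `g ∈ S⟦X⟧`, `g ≡ Σ_x a_n(x)(1+X)^x (mod ω_n)`
for all `n`** (`S` `(p)`-adically complete). [cite: Washington1997, §7.1 Theorem 7.1] -/
theorem existsUnique_forall_omega_dvd_sub_amice [IsAdicComplete (Ideal.span {(p : S)}) S] (a : ∀ n, ZMod (p ^ n) → S)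
    (ha : open scoped Classical in ∀ n (x : ZMod (p ^ n)), a n x = ∑ y ∈ univ.filter (fun y : ZMod (p ^ (n + 1)) =>
      ZMod.castHom (pow_dvd_pow p n.le_succ) (ZMod (p ^ n)) y = x), a (n + 1) y) :
    ∃! g : PowerSeries S, ∀ n, ((1 + PowerSeries.X : PowerSeries S) ^ p ^ n - 1) ∣
      g - ∑ x : ZMod (p ^ n), PowerSeries.C (a n x) * (1 + PowerSeries.X) ^ x.val := by
  classical
  obtain ⟨g, hg⟩ := exists_forall_omega_dvd_sub p
    (fun n => ∑ x : ZMod (p ^ n), PowerSeries.C (a n x) * (1 + PowerSeries.X) ^ x.val) fun n => by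
      have e : (∑ x : ZMod (p ^ n), PowerSeries.C (a n x) * (1 + PowerSeries.X) ^ x.val) =
          ∑ x : ZMod (p ^ n), PowerSeries.C (∑ y ∈ univ.filter (fun y : ZMod (p ^ (n + 1)) =>
            ZMod.castHom (pow_dvd_pow p n.le_succ) (ZMod (p ^ n)) y = x), a (n + 1) y) * (1 + PowerSeries.X) ^ x.val :=
        sum_congr rfl fun x _ => by rw [← ha n x]
      rw [e]
      exact omega_dvd_amice_sub_amice_pushforward p n (a (n + 1))
  refine ⟨g, hg, fun g' hg' => eq_of_forall_omega_dvd_sub p fun n => ?_⟩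
  have h := dvd_sub (hg' n) (hg n)
  rwa [sub_sub_sub_cancel_right] at h

/-! ### One level: `S⟦X⟧/(ω_n) ≅ S[ℤ/p^nℤ]` -/

/-- ★★ **Every `f ∈ S⟦X⟧` is `≡ Σ_x a(x)(1+X)^x (mod ω_n)` for a UNIQUE `a : ℤ/p^n → S`** (`S` `(p)`-adically complete, `p` not a unit):
Weierstrass division by `ω_n` gives a remainder of degree `< p^n`, which is `taylor 1` of a unique polynomial `Σ_x a(x) X^x`; uniqueness by
the uniqueness of Weierstrass division. [cite: Washington1997, §7.1 Proposition 7.2] -/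
theorem existsUnique_omega_dvd_sub_amice [IsAdicComplete (Ideal.span {(p : S)}) S] (hI : Ideal.span {(p : S)} ≠ ⊤) (n : ℕ)
    (f : PowerSeries S) :
    ∃! a : ZMod (p ^ n) → S, ((1 + PowerSeries.X : PowerSeries S) ^ p ^ n - 1) ∣
      f - ∑ x : ZMod (p ^ n), PowerSeries.C (a x) * (1 + PowerSeries.X) ^ x.val := by
  haveI : NeZero (p ^ n) := ⟨pow_ne_zero _ hp.out.ne_zero⟩
  have H := isWeierstrassDivisorAt_omega p hI n
  have hdiv := H.isWeierstrassDivisionAt_div_mod f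
  -- existence
  obtain ⟨Q, hQ⟩ : ∃ Q : Polynomial S, Q = Polynomial.taylor (-1 : S) (H.mod f) := ⟨_, rfl⟩
  have hQdeg : Q.natDegree < p ^ n := by
    rw [hQ, Polynomial.natDegree_taylor]
    have h1 := hdiv.degree_lt
    rw [order_map_omega p hI n] at h1
    by_cases h0 : H.mod f = 0
    · rw [h0, Polynomial.natDegree_zero]; exact pow_pos hp.out.pos n
    · exact (Polynomial.natDegree_lt_iff_degree_lt h0).mpr h1
  have hQsum : Q = ∑ x : ZMod (p ^ n), Polynomial.monomial x.val (Q.coeff x.val) := by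
    conv_lhs => rw [Q.as_sum_range' (p ^ n) hQdeg]
    exact sum_range_eq_sum_zmod (p ^ n) fun i => Polynomial.monomial i (Q.coeff i)
  have hmod : ((H.mod f : Polynomial S) : PowerSeries S) =
      ∑ x : ZMod (p ^ n), PowerSeries.C (Q.coeff x.val) * (1 + PowerSeries.X) ^ x.val := by
    rw [← coe_taylor_sum_monomial, ← hQsum, hQ, Polynomial.taylor_taylor, add_neg_cancel, Polynomial.taylor_zero]
  have hex : ((1 + PowerSeries.X : PowerSeries S) ^ p ^ n - 1) ∣
      f - ∑ x : ZMod (p ^ n), PowerSeries.C (Q.coeff x.val) * (1 + PowerSeries.X) ^ x.val := by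
    refine ⟨H.div f, ?_⟩
    rw [← hmod]
    exact sub_eq_iff_eq_add.mpr hdiv.eq_mul_add
  refine ⟨fun x => Q.coeff x.val, hex, fun a' ha' => ?_⟩
  -- uniqueness: the difference of the two transforms is `taylor 1` of a polynomial of degree `< p^n` divisible by `ω_n`
  obtain ⟨t, ht⟩ : ((1 + PowerSeries.X : PowerSeries S) ^ p ^ n - 1) ∣
      (∑ x : ZMod (p ^ n), PowerSeries.C (Q.coeff x.val) * (1 + PowerSeries.X) ^ x.val) -
        ∑ x : ZMod (p ^ n), PowerSeries.C (a' x) * (1 + PowerSeries.X) ^ x.val := by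
    have h := dvd_sub ha' hex
    rwa [sub_sub_sub_cancel_left] at h
  obtain ⟨D, hD⟩ : ∃ D : Polynomial S, D = (∑ x : ZMod (p ^ n), Polynomial.monomial x.val (Q.coeff x.val)) -
      ∑ x : ZMod (p ^ n), Polynomial.monomial x.val (a' x) := ⟨_, rfl⟩
  have hP : (∑ x : ZMod (p ^ n), PowerSeries.C (Q.coeff x.val) * (1 + PowerSeries.X) ^ x.val) -
      ∑ x : ZMod (p ^ n), PowerSeries.C (a' x) * (1 + PowerSeries.X) ^ x.val = ((Polynomial.taylor (1 : S) D : Polynomial S) : PowerSeries S) := by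
    rw [hD, map_sub, Polynomial.coe_sub, coe_taylor_sum_monomial, coe_taylor_sum_monomial]
  have hDdeg : D.natDegree < p ^ n := by
    rw [hD]
    refine lt_of_le_of_lt (Polynomial.natDegree_sub_le _ _) (max_lt (natDegree_sum_monomial_lt p n _) (natDegree_sum_monomial_lt p n _))
  have hdeg : (Polynomial.taylor (1 : S) D).degree <
      ((PowerSeries.map (Ideal.Quotient.mk (Ideal.span {(p : S)}))) ((1 + PowerSeries.X : PowerSeries S) ^ p ^ n - 1)).order.toNat := by
    rw [order_map_omega p hI n, Polynomial.degree_taylor]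
    exact lt_of_le_of_lt Polynomial.degree_le_natDegree (WithBot.coe_lt_coe.mpr hDdeg)
  rw [hP] at ht
  have hz := (H.eq_zero_of_mul_eq hdeg ht.symm).2
  have hD0 : D = 0 := Polynomial.taylor_injective (1 : S) (by rw [hz, map_zero])
  rw [hD, sub_eq_zero] at hD0
  exact (eq_of_sum_monomial_eq p n hD0).symm

/-! ### The isomorphism `S⟦X⟧ ≅ Λ(ℤ_p, S)` -/

/-- ★★★ **Every `g ∈ S⟦X⟧` is the Amice transform of a UNIQUE push-forward-compatible family `(a_n : ℤ/p^n → S)`**: with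
`existsUnique_forall_omega_dvd_sub_amice` this is the bijection `Λ(ℤ_p, S) = lim←_n S[ℤ/p^nℤ] ≅ S⟦X⟧` (`S` `(p)`-adically complete,
`p` not a unit). [cite: Washington1997, §7.1 Theorem 7.1] -/
theorem existsUnique_compatible_amice [IsAdicComplete (Ideal.span {(p : S)}) S] (hI : Ideal.span {(p : S)} ≠ ⊤) (g : PowerSeries S) :
    open scoped Classical in
    ∃! a : ∀ n, ZMod (p ^ n) → S,
      (∀ n (x : ZMod (p ^ n)), a n x = ∑ y ∈ univ.filter (fun y : ZMod (p ^ (n + 1)) =>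
        ZMod.castHom (pow_dvd_pow p n.le_succ) (ZMod (p ^ n)) y = x), a (n + 1) y) ∧
      ∀ n, ((1 + PowerSeries.X : PowerSeries S) ^ p ^ n - 1) ∣
        g - ∑ x : ZMod (p ^ n), PowerSeries.C (a n x) * (1 + PowerSeries.X) ^ x.val := by
  classical
  have hlev := fun n => existsUnique_omega_dvd_sub_amice p hI n g
  choose a ha using fun n => (hlev n).exists
  refine ⟨a, ⟨fun n x => ?_, ha⟩, ?_⟩
  · -- compatibility from levelwise uniqueness
    have hpush : ((1 + PowerSeries.X : PowerSeries S) ^ p ^ n - 1) ∣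
        g - ∑ x : ZMod (p ^ n), PowerSeries.C (∑ y ∈ univ.filter (fun y : ZMod (p ^ (n + 1)) =>
          ZMod.castHom (pow_dvd_pow p n.le_succ) (ZMod (p ^ n)) y = x), a (n + 1) y) * (1 + PowerSeries.X) ^ x.val := by
      have h1 : ((1 + PowerSeries.X : PowerSeries S) ^ p ^ n - 1) ∣
          g - ∑ y : ZMod (p ^ (n + 1)), PowerSeries.C (a (n + 1) y) * (1 + PowerSeries.X) ^ y.val :=
        dvd_trans (omega_dvd_omega p n.le_succ) (ha (n + 1))
      have h2 := dvd_add h1 (omega_dvd_amice_sub_amice_pushforward p n (a (n + 1)))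
      rwa [sub_add_sub_cancel] at h2
    exact congrFun ((hlev n).unique (ha n) hpush) x
  · rintro b ⟨-, hb⟩
    funext n
    exact (hlev n).unique (hb n) (ha n)

end IwasawaOmega

end Literature.NumberTheory.EllipticCurves
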